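import Summits.CriticalPhenomena.PercolationContinuityZ3.Theorems.SubcritExchangeUniformity.Negative.VerticalRusso
import Literature.Probability.LatticeModels.IsoradialPercolationProofs

/-!
# `SubcritExchangeUniformity` (K⁻, crux stmt-CriticalPhenomena-16062), negative lane, supplement:
# the diagonal identity `∂_pΘ_n(p,p) = 2 ∂_tΘ_n(p,p)` (cubic symmetry) and the pinned slope `σ(p₃) = 1/2`

Tightness material from the crux disprover (cdisprove, cycle 1); nothing here asserts a Theses decl;
no definitions. On the diagonal `t = p` the label-coupled anisotropic family IS isotropic bond
percolation on `ℤ³` (`prodBernoulli_param_diag`, via `prodBernoulli_indicator_holds`), the one-arm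
event `{0 ↔ ∂Λ_n in Λ_n}` and its pivotal events are invariant under the unsigned coordinate
permutations (`preimage_relabel_siteToBoundary`, `preimage_relabel_pivotal`; automorphisms
`zdSignedPermIso π 1`, transport `relabel_mem_openConnIn`, `bondPercolation_real_preimage_relabel_iso`,
and the transport of pivotality `isPivotal_relabel_iff`), hence the three directional Russo sums of
pivotal probabilities agree (`sum_wdir_eq`), and the two-parameter Russo formulas in the `p`- and
`t`-directions (`hasDerivAt_ThetaBox_p`, `hasDerivAt_ThetaBox_t`) give
`deriv (fun q => Θ_n(q,p)) p = 2 * deriv (fun s => Θ_n(p,s)) p` for every `n` and `p ∈ (0,1)`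
(`deriv_p_eq_two_mul_deriv_t_diag`): the finite-volume exchange rate is EXACTLY `1/2` on the
diagonal, for every `n`. Consequence for the crux (`sigma_eq_half_at_diagonal`): at a level
`t ∈ (0,1)` with `p_c(t) = t` — the isotropic point `t = p₃ = p_c(ℤ³)`, by the route's
DiagonalOnCurve — any slope `σ₀` for which the K⁻ strip inequality holds for every `η > 0` equals
`1/2`. K⁻ leaves no freedom there (consistent with MC-aniso-r1: `a_n(p₃,p₃) − 1/2 = +0.0012(10),
−0.0000(8), +0.0002(10), −0.0009(10)` for `n = 6, 8, 11, 16`), and no small-`n` certificate against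
K⁻ can come from the diagonal.
-/

noncomputable section

namespace Summit.CriticalPhenomena.PercolationContinuityZ3.Theorems.SubcritExchangeUniformity.Negative

open MeasureTheory Filter Topology
open Literature.Probability.Percolation Literature.Probability.LatticeModels
open Literature.Probability.Percolation.DCT16

namespace Diag

/-- Every lattice edge of `ℤ³` has a direction. [folklore] -/
theorem exists_dir_of_mem_edgeSet {e : Sym2 (Site 3)} (he : e ∈ (zdGraph 3).edgeSet) :
    ∃ i, e ∈ dirBonds i := by
  induction e using Sym2.ind with
  | h x y =>
    rw [SimpleGraph.mem_edgeSet, zdGraph_adj_iff] at he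
    obtain ⟨i, h | h⟩ := he
    · exact ⟨i, x, by rw [h]⟩
    · exact ⟨i, y, by rw [h, Sym2.eq_swap]⟩

/-- Directions are exclusive. [folklore] -/
theorem dir_unique {e : Sym2 (Site 3)} {i j : Fin 3} (hi : e ∈ dirBonds i) (hj : e ∈ dirBonds j) :
    i = j := by
  obtain ⟨x, rfl⟩ := hi
  obtain ⟨y, hy⟩ := hj
  rw [Sym2.eq_iff] at hy
  by_contra hij
  rcases hy with ⟨h1, h2⟩ | ⟨h1, h2⟩
  · subst h1
    have h3 := congr_fun (add_left_cancel h2) i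
    simp [hij] at h3
  · have h3 := congr_fun h2 i
    rw [h1] at h3
    simp [hij] at h3

/-- A lattice edge is non-vertical iff it is an `x`- or a `y`-bond. [folklore] -/
theorem not_vert_iff {e : Sym2 (Site 3)} (he : e ∈ (zdGraph 3).edgeSet) :
    e ∉ dirBonds 2 ↔ e ∈ dirBonds 0 ∨ e ∈ dirBonds 1 := by
  constructor
  · intro h2
    obtain ⟨i, hi⟩ := exists_dir_of_mem_edgeSet he
    fin_cases i
    · exact Or.inl hi
    · exact Or.inr hi
    · exact absurd hi h2
  · rintro (h | h) h2
    · exact absurd (dir_unique h h2) (by decide)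
    · exact absurd (dir_unique h h2) (by decide)

/-- Horizontal weight = `x`-weight + `y`-weight. [folklore] -/
theorem wh_eq (e : Sym2 (Site 3)) : wh e = wdir 0 e + wdir 1 e := by
  by_cases he : e ∈ (zdGraph 3).edgeSet
  · by_cases hv : e ∈ dirBonds 2
    · have h0 : e ∉ dirBonds 0 := fun h => absurd (dir_unique h hv) (by decide)
      have h1 : e ∉ dirBonds 1 := fun h => absurd (dir_unique h hv) (by decide)
      have hv' : e ∈ vertBonds := hv
      simp [wh, wdir, he, hv', h0, h1]
    · have hv' : e ∉ vertBonds := hv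
      rcases (not_vert_iff he).1 hv with h | h
      · have h1 : e ∉ dirBonds 1 := fun h' => absurd (dir_unique h h') (by decide)
        simp [wh, wdir, he, hv', h, h1]
      · have h0 : e ∉ dirBonds 0 := fun h' => absurd (dir_unique h' h) (by decide)
        simp [wh, wdir, he, hv', h, h0]
  · simp [wh, wdir, he]

/-- Horizontal weight `1` on non-vertical lattice edges. [folklore] -/
theorem wh_of_not_vert {e : Sym2 (Site 3)} (he : e ∈ (zdGraph 3).edgeSet) (hv : e ∉ vertBonds) :
    wh e = 1 := by
  simp only [wh]
  rw [if_pos ⟨he, hv⟩]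

/-- Horizontal weight `0` on vertical bonds. [folklore] -/
theorem wh_of_vert {e : Sym2 (Site 3)} (hv : e ∈ vertBonds) : wh e = 0 := by
  simp only [wh]
  rw [if_neg fun h => h.2 hv]

/-- Horizontal weight `0` off the edge set. [folklore] -/
theorem wh_of_not_mem {e : Sym2 (Site 3)} (he : e ∉ (zdGraph 3).edgeSet) : wh e = 0 := by
  simp only [wh]
  rw [if_neg fun h => he h.1]

/-- **Two-parameter Russo in the `p`-direction** at an interior `p ∈ (0,1)` (any real `t`):
`∂_pΘ_n(p,t) = Σ_{e ∈ Λ_n.sym2, e non-vertical lattice edge} P_{(p,t)}(e pivotal)`. [folklore] -/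
theorem hasDerivAt_ThetaBox_p (n : ℕ) {p : ℝ} (hp : p ∈ Set.Ioo (0 : ℝ) 1) (t : ℝ) :
    HasDerivAt (fun q => ThetaBox n q t)
      (∑ e ∈ (box 3 n).sym2,
        wh e * (prodBernoulli (param p t)).real {ω | IsPivotal (siteToBoundary 3 n) e ω}) p := by
  classical
  have hfun : (fun q => ThetaBox n q t) =
      fun q => (prodBernoulli (param q t)).real (siteToBoundary 3 n) :=
    funext fun q => ThetaBox_eq n q t
  rw [hfun]
  refine hasDerivAt_prodBernoulli_real (fun q : ℝ => param q t) (isUpperSet_siteToBoundary 3 n)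
    (determinedBy_siteToBoundary 3 n) p wh fun e _ => ?_
  by_cases he : e ∈ (zdGraph 3).edgeSet
  · by_cases hv : e ∈ vertBonds
    · rw [wh_of_vert hv]
      have hc : (fun q : ℝ => (param q t e : ℝ)) =
          fun _ => ((Set.projIcc (0 : ℝ) 1 zero_le_one t : unitInterval) : ℝ) := by
        funext q
        rw [param_of_mem he, τPT_of_vert hv]
      rw [hc]
      exact hasDerivAt_const _ _
    · rw [wh_of_not_vert he hv]
      have heq : (fun q : ℝ => q) =ᶠ[𝓝 p] fun q : ℝ => (param q t e : ℝ) := by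
        filter_upwards [Ioo_mem_nhds hp.1 hp.2] with q hq
        rw [param_of_mem he, τPT_of_not_vert hv, Set.projIcc_of_mem _ (Set.Ioo_subset_Icc_self hq)]
      exact (hasDerivAt_id p).congr_of_eventuallyEq heq.symm
  · rw [wh_of_not_mem he]
    have hc : (fun q : ℝ => (param q t e : ℝ)) = fun _ => (0 : ℝ) := by
      funext q
      rw [param_of_not_mem he]
      rfl
    rw [hc]
    exact hasDerivAt_const _ _

/-! ### The axis swaps `i ↔ 2` and their action on bonds, boxes, the one-arm event, pivotality -/

/-- `pairPerm π` maps direction-`j` bonds to direction-`π j` bonds. [folklore] -/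
theorem pairPerm_mem_dirBonds {π : Equiv.Perm (Fin 3)} {j : Fin 3} {e : Sym2 (Site 3)}
    (h : e ∈ dirBonds j) : pairPerm π e ∈ dirBonds (π j) := by
  obtain ⟨x, rfl⟩ := h
  refine ⟨Site.signedPerm π 1 x, ?_⟩
  change sym2Equiv (Site.signedPerm π 1) s(x, x + Pi.single j 1) = _
  rw [sym2Equiv_mk, Site.signedPerm_add, signedPerm_one_single]

/-- The inverse of an unsigned permutation is the unsigned inverse permutation. [folklore] -/
theorem signedPerm_one_symm (π : Equiv.Perm (Fin 3)) :
    (Site.signedPerm π (1 : Fin 3 → ℤˣ)).symm = Site.signedPerm π.symm 1 := by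
  rw [Site.signedPerm_symm]
  rfl

/-- `pairPerm π.symm` inverts `pairPerm π`. [folklore] -/
theorem pairPerm_symm_apply (π : Equiv.Perm (Fin 3)) (e : Sym2 (Site 3)) :
    pairPerm π.symm (pairPerm π e) = e := by
  have h : (pairPerm π).symm = pairPerm π.symm := by
    change (sym2Equiv (Site.signedPerm π 1)).symm = sym2Equiv (Site.signedPerm π.symm 1)
    rw [sym2Equiv_symm, signedPerm_one_symm]
  rw [← h]
  exact (pairPerm π).symm_apply_apply e

/-- Direction transport is an equivalence. [folklore] -/
theorem pairPerm_mem_dirBonds_iff (π : Equiv.Perm (Fin 3)) (j : Fin 3) (e : Sym2 (Site 3)) :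
    pairPerm π e ∈ dirBonds (π j) ↔ e ∈ dirBonds j := by
  refine ⟨fun h => ?_, pairPerm_mem_dirBonds⟩
  have h' := pairPerm_mem_dirBonds (π := π.symm) h
  rwa [pairPerm_symm_apply, Equiv.symm_apply_apply] at h'

/-- `pairPerm π` preserves the edge set. [folklore] -/
theorem pairPerm_mem_edgeSet_iff (π : Equiv.Perm (Fin 3)) (e : Sym2 (Site 3)) :
    pairPerm π e ∈ (zdGraph 3).edgeSet ↔ e ∈ (zdGraph 3).edgeSet :=
  sym2Equiv_mem_edgeSet_iff (permIso π) e

/-- `pairPerm π` preserves the pairs of `Λ_n`. [folklore] -/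
theorem pairPerm_mem_sym2_box_iff (π : Equiv.Perm (Fin 3)) (n : ℕ) (e : Sym2 (Site 3)) :
    e ∈ (box 3 n).sym2 ↔ pairPerm π e ∈ (box 3 n).sym2 := by
  induction e using Sym2.ind with
  | h x y =>
    change _ ↔ sym2Equiv (Site.signedPerm π 1) s(x, y) ∈ (box 3 n).sym2
    rw [sym2Equiv_mk, Finset.mk_mem_sym2_iff, Finset.mk_mem_sym2_iff, signedPerm_mem_box_iff,
      signedPerm_mem_box_iff]

/-- Unsigned permutations preserve `∂Λ_n`. [folklore] -/
theorem signedPerm_mem_innerBoundary {π : Equiv.Perm (Fin 3)} {n : ℕ} {y : Site 3}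
    (hy : y ∈ innerBoundary (zdGraph 3) (box 3 n)) :
    Site.signedPerm π 1 y ∈ innerBoundary (zdGraph 3) (box 3 n) := by
  rw [mem_innerBoundary_iff] at hy ⊢
  obtain ⟨hyb, z, hz, hadj⟩ := hy
  refine ⟨(signedPerm_mem_box_iff π 1).2 hyb, Site.signedPerm π 1 z,
    fun h => hz ((signedPerm_mem_box_iff π 1).1 h), ?_⟩
  exact (permIso π).map_adj_iff.2 hadj

/-- Relabelling along an unsigned permutation preserves the one-arm event (one direction).
[folklore] -/
theorem relabel_mem_siteToBoundary {π : Equiv.Perm (Fin 3)} {n : ℕ} {ω : Set (Sym2 (Site 3))}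
    (hω : ω ∈ siteToBoundary 3 n) : BondConfig.relabel (pairPerm π) ω ∈ siteToBoundary 3 n := by
  obtain ⟨y, hy, hconn⟩ := hω
  have h := relabel_mem_openConnIn (Site.signedPerm π 1) hconn
  rw [signedPerm_image_box, Site.signedPerm_zero] at h
  exact ⟨Site.signedPerm π 1 y, signedPerm_mem_innerBoundary hy, h⟩

/-- **The one-arm event is invariant under the unsigned coordinate permutations.** [folklore] -/
theorem preimage_relabel_siteToBoundary (π : Equiv.Perm (Fin 3)) (n : ℕ) :
    BondConfig.relabel (pairPerm π) ⁻¹' siteToBoundary 3 n = siteToBoundary 3 n := by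
  ext ω
  refine ⟨fun h => ?_, fun h => relabel_mem_siteToBoundary h⟩
  have h' := relabel_mem_siteToBoundary (π := π.symm) h
  have e1 : BondConfig.relabel (pairPerm π.symm) (BondConfig.relabel (pairPerm π) ω) = ω := by
    have := relabel_symm_relabel (Site.signedPerm π 1) ω
    rwa [signedPerm_one_symm] at this
  rwa [e1] at h'

/-- **Pivotality is transported by relabelling** (any bijection of pairs): `e2 z` is pivotal for
`A` in `e2 '' ω` iff `z` is pivotal for `(e2 '' ·)⁻¹ A` in `ω`. [folklore] -/
theorem isPivotal_relabel_iff {V W : Type*} (e2 : Sym2 V ≃ Sym2 W) (A : Set (Set (Sym2 W)))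
    (z : Sym2 V) (ω : Set (Sym2 V)) :
    IsPivotal A (e2 z) (BondConfig.relabel e2 ω) ↔ IsPivotal (BondConfig.relabel e2 ⁻¹' A) z ω := by
  simp only [IsPivotal, Set.mem_preimage, BondConfig.relabel_apply, Set.image_insert_eq,
    Set.image_sdiff e2.injective, Set.image_singleton]

/-- The pivotal event of `pairPerm π e` pulls back to the pivotal event of `e`. [folklore] -/
theorem preimage_relabel_pivotal (π : Equiv.Perm (Fin 3)) (n : ℕ) (e : Sym2 (Site 3)) :
    BondConfig.relabel (pairPerm π) ⁻¹' {ω | IsPivotal (siteToBoundary 3 n) (pairPerm π e) ω} =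
      {ω | IsPivotal (siteToBoundary 3 n) e ω} := by
  ext ω
  simp only [Set.mem_preimage, Set.mem_setOf_eq]
  rw [isPivotal_relabel_iff, preimage_relabel_siteToBoundary]

/-! ### The diagonal measure is isotropic bond percolation; equality of directional sums -/

/-- On the diagonal the parameter field is `projIcc p` on `E(ℤ³)` and `0` off it. [folklore] -/
theorem param_diag (p : ℝ) :
    param p p = fun e => if e ∈ (zdGraph 3).edgeSet then Set.projIcc (0 : ℝ) 1 zero_le_one p else 0 := by
  funext e
  by_cases he : e ∈ (zdGraph 3).edgeSet
  · rw [param_of_mem he, if_pos he]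
    by_cases hv : e ∈ vertBonds
    · rw [τPT_of_vert hv]
    · rw [τPT_of_not_vert hv]
  · rw [param_of_not_mem he, if_neg he]

/-- **On the diagonal the family is isotropic bond percolation on `ℤ³`** at parameter
`projIcc p`. [folklore] -/
theorem prodBernoulli_param_diag (p : ℝ) :
    prodBernoulli (param p p) = bondPercolation (zdGraph 3) (Set.projIcc (0 : ℝ) 1 zero_le_one p) := by
  rw [param_diag]
  exact prodBernoulli_indicator_holds _ _

/-- **Pivotal probabilities are invariant under the axis permutations** (on the diagonal).
[folklore] -/
theorem real_pivotal_pairPerm (π : Equiv.Perm (Fin 3)) (n : ℕ) (p : ℝ) (e : Sym2 (Site 3)) :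
    (prodBernoulli (param p p)).real {ω | IsPivotal (siteToBoundary 3 n) (pairPerm π e) ω} =
      (prodBernoulli (param p p)).real {ω | IsPivotal (siteToBoundary 3 n) e ω} := by
  rw [prodBernoulli_param_diag, ← preimage_relabel_pivotal π n e]
  exact (bondPercolation_real_preimage_relabel_iso (permIso π) _ _).symm

/-- **Directional pivotal sums agree on the diagonal**: for every direction `i`,
`Σ_{e ∈ Λ_n.sym2} w_i(e) P(e pivotal) = Σ_{e ∈ Λ_n.sym2} w_2(e) P(e pivotal)` at `t = p`
(the axis swap `i ↔ 2`). [folklore] -/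
theorem sum_wdir_eq (i : Fin 3) (n : ℕ) (p : ℝ) :
    ∑ e ∈ (box 3 n).sym2, wdir 2 e *
        (prodBernoulli (param p p)).real {ω | IsPivotal (siteToBoundary 3 n) e ω} =
      ∑ e ∈ (box 3 n).sym2, wdir i e *
        (prodBernoulli (param p p)).real {ω | IsPivotal (siteToBoundary 3 n) e ω} := by
  refine Finset.sum_equiv (pairPerm (Equiv.swap 2 i)) (fun e => pairPerm_mem_sym2_box_iff _ n e)
    fun e _ => ?_
  rw [real_pivotal_pairPerm]
  congr 1
  have hdir : (pairPerm (Equiv.swap 2 i) e ∈ dirBonds i) ↔ e ∈ dirBonds 2 := by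
    have := pairPerm_mem_dirBonds_iff (Equiv.swap 2 i) 2 e
    rwa [Equiv.swap_apply_left] at this
  have hE := pairPerm_mem_edgeSet_iff (Equiv.swap 2 i) e
  simp only [wdir]
  by_cases h : e ∈ (zdGraph 3).edgeSet ∧ e ∈ dirBonds 2
  · rw [if_pos h, if_pos ⟨hE.2 h.1, hdir.2 h.2⟩]
  · rw [if_neg h, if_neg fun h' => h ⟨hE.1 h'.1, hdir.1 h'.2⟩]

/-! ## §7 The diagonal identity `∂_pΘ_n(p,p) = 2 ∂_tΘ_n(p,p)` and the pinned slope `σ = 1/2` -/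

/-- **Cubic symmetry of the exchange rate on the diagonal**: for every `n` and `p ∈ (0,1)`,
`deriv (fun q => Θ_n(q,p)) p = 2 * deriv (fun s => Θ_n(p,s)) p`, i.e. `a_n(p,p) = 1/2` whenever
`∂_pΘ_n(p,p) ≠ 0` — z-bonds are one third of the bonds and `{0 ↔ ∂Λ_n}` is invariant under the axis
swaps. [folklore] -/
theorem deriv_p_eq_two_mul_deriv_t_diag (n : ℕ) {p : ℝ} (hp : p ∈ Set.Ioo (0 : ℝ) 1) :
    deriv (fun q => ThetaBox n q p) p = 2 * deriv (fun s => ThetaBox n p s) p := by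
  rw [(hasDerivAt_ThetaBox_p n hp p).deriv, (hasDerivAt_ThetaBox_t n p hp).deriv]
  have hsplit : ∀ e ∈ (box 3 n).sym2,
      wh e * (prodBernoulli (param p p)).real {ω | IsPivotal (siteToBoundary 3 n) e ω} =
        wdir 0 e * (prodBernoulli (param p p)).real {ω | IsPivotal (siteToBoundary 3 n) e ω} +
        wdir 1 e * (prodBernoulli (param p p)).real {ω | IsPivotal (siteToBoundary 3 n) e ω} :=
    fun e _ => by rw [wh_eq, add_mul]
  rw [Finset.sum_congr rfl hsplit, Finset.sum_add_distrib, ← sum_wdir_eq 0, ← sum_wdir_eq 1,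
    wz_eq_wdir, two_mul]

end Diag

/-- **Rigidity at a diagonal point of the curve.** If at a level `t ∈ (0,1)` with `p_c(t) = t`
the exchange-rate inequality of K⁻ holds for EVERY `η > 0` (with some `δ(η) > 0`, `m(η)`) and a
slope `σ₀`, then `σ₀ = 1/2`: K⁻ leaves no freedom at the isotropic point `t = p₃ = p_c(ℤ³)` (where
`p_c(p₃) = p₃` is the route's DiagonalOnCurve). A tightness lemma — consistent, not a
contradiction. [folklore] -/
theorem sigma_eq_half_at_diagonal {t : ℝ} (ht : t ∈ Set.Ioo (0 : ℝ) 1) (hcurve : pcurve t = t)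
    {σ₀ : ℝ}
    (h : ∀ η > (0 : ℝ), ∃ δ > (0 : ℝ), ∃ m : ℕ, ∀ n ≥ m, ∀ p : ℝ, pcurve t - δ ≤ p → p ≤ pcurve t →
      |deriv (fun s => ThetaBox n p s) t - σ₀ * deriv (fun q => ThetaBox n q t) p| ≤
        η * deriv (fun q => ThetaBox n q t) p) :
    σ₀ = 1 / 2 := by
  by_contra hne
  have hgap : 0 < |1 / 2 - σ₀| := abs_pos.2 (sub_ne_zero.2 (Ne.symm hne))
  obtain ⟨δ, hδ, m, hm⟩ := h (|1 / 2 - σ₀| / 2) (half_pos hgap)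
  have key := hm (max m 1) (le_max_left _ _) t (by rw [hcurve]; linarith) (by rw [hcurve])
  set D := deriv (fun q => ThetaBox (max m 1) q t) t with hDdef
  set T := deriv (fun s => ThetaBox (max m 1) t s) t with hTdef
  have hDT : D = 2 * T := Diag.deriv_p_eq_two_mul_deriv_t_diag (max m 1) ht
  have hT : 0 < T := deriv_t_pos (max m 1) (le_max_right _ _) ht.2 ht
  have hD : 0 < D := by rw [hDT]; linarith
  rw [show T = (1 / 2) * D by rw [hDT]; ring] at key
  rw [show (1 / 2) * D - σ₀ * D = (1 / 2 - σ₀) * D by ring, abs_mul, abs_of_pos hD] at key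
  have := mul_lt_mul_of_pos_right (half_lt_self hgap) hD
  linarith

end Summit.CriticalPhenomena.PercolationContinuityZ3.Theorems.SubcritExchangeUniformity.Negative

end
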